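import Mathlib
import Literature.NumberTheory.Transcendental.KZProduct
import Literature.NumberTheory.Transcendental.KZSemiCanonicalReductionProofs
import Literature.NumberTheory.Transcendental.KZSubcalculusInvariants
import Summits.KontsevichZagierPeriods.KontsevichZagierPeriods.Theorems.SoloInformedPolyJacobian
import Summits.KontsevichZagierPeriods.KontsevichZagierPeriods.Theorems.SoloInformedKZStokesCells
import HarnessLib
import HarnessLib.Audit

/-!
# SoloInformed — the disc as four quarters (steps 1–2 of `π = 4 ∫₀¹ dt/(1+t²)`)

First half of the proof, inside the audited four-move calculus
`Literature.NumberTheory.Transcendental.KZ.relations`, that the class of the disc representation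
`KZ.piRep = [{x²+y²≤1}, 1]` is four times the class of the arctangent representation
`soloInformedArctanRep = [[0,1], 1/(1+t²)]` (the assembly is in `SoloInformedPiDisc`):

1. rule (1a): the disc is the almost-disjoint union of its four open-quadrant quarters
   (`KZ.of_sub_sum_of_mem_relations`, the axes being null) —
   `soloInformed_piRep_sub_sum_quarter_mem_relations`;
2. rule (2): the sign flips `(x, y) ↦ (±x, ±y)` (linear involutions, `|det| = 1`) identify the
   four quarters — `soloInformed_quarter_sub_quarter_zero_mem_relations`, via the general
   `soloInformed_of_sub_of_linInvol_mem_relations`.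

Residency `solo-KontsevichZagierPeriods-informed` (PLAN.md, session s15).
References: M. Kontsevich, D. Zagier, *Periods* (2001), §1.1–§1.2.
-/

noncomputable section

open MeasureTheory Set Filter
open scoped Topology

namespace Summit.KontsevichZagierPeriods.KontsevichZagierPeriods.Theorems

open Literature.NumberTheory.Transcendental Literature.NumberTheory.Transcendental.KZ
open Literature.ModelTheory.ExponentialFields (IsSemialgebraic isSemialgebraic_setOf_eval_le
  isSemialgebraic_setOf_eval_lt isSemialgebraic_setOf_eval_pos)

/-! ### The arctangent representation `[[0,1], 1/(1+t²)]` -/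

/-- `t ↦ 1/(1+t²)` is a `ℚ`-semialgebraic function on any `ℚ`-semialgebraic subset of `ℝ¹`. -/
theorem soloInformed_isSemialgebraicFunOn_arctanFun {s : Set (Fin 1 → ℝ)}
    (hs : IsSemialgebraic ℚ s) : IsSemialgebraicFunOn ℚ s (fun x => 1 / (1 + x 0 ^ 2)) := by
  have h := isSemialgebraicFunOn_aeval_div_aeval hs (1 : MvPolynomial (Fin 1) ℚ)
    (1 + MvPolynomial.X 0 ^ 2) (fun x _ => by
      simp only [map_add, map_one, map_pow, MvPolynomial.aeval_X]
      positivity)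
  simpa using h

/-- `t ↦ 1/(1+t²)` is continuous on `ℝ¹`. -/
theorem soloInformed_continuous_arctanFun :
    Continuous (fun x : Fin 1 → ℝ => 1 / (1 + x 0 ^ 2)) :=
  continuous_const.div (continuous_const.add ((continuous_apply 0).pow 2))
    fun x => by positivity

/-- The arctangent representation `[[0,1], 1/(1+t²)]` (value `π/4`). -/
def soloInformedArctanRep : IntegralRep 1 :=
  soloInformedIRep (fun x => 1 / (1 + x 0 ^ 2))
    (soloInformed_isSemialgebraicFunOn_arctanFun isSemialgebraic_soloInformedUnitI)
    soloInformed_continuous_arctanFun.continuousOn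

/-- Domain of the arctangent representation. -/
@[simp] theorem soloInformedArctanRep_domain :
    soloInformedArctanRep.domain = soloInformedUnitI := rfl

/-- Integrand of the arctangent representation. -/
@[simp] theorem soloInformedArctanRep_integrand :
    soloInformedArctanRep.integrand = fun x => 1 / (1 + x 0 ^ 2) := rfl

/-! ### Step 1: the four quarters of the disc -/

/-- The quarter `{ε₀ x > 0, ε₁ y > 0}` of the closed unit disc (`ε₀, ε₁ = ±1`). -/
def soloInformedQuarterDisc (ε₀ ε₁ : ℚ) : Set (Fin 2 → ℝ) :=
  {x | 0 < (ε₀ : ℝ) * x 0 ∧ 0 < (ε₁ : ℝ) * x 1 ∧ x 0 ^ 2 + x 1 ^ 2 ≤ 1}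

/-- Quarters of the disc are `ℚ`-semialgebraic. -/
theorem isSemialgebraic_soloInformedQuarterDisc (ε₀ ε₁ : ℚ) :
    IsSemialgebraic ℚ (soloInformedQuarterDisc ε₀ ε₁) := by
  have h0 := isSemialgebraic_setOf_eval_pos (k := ℚ) (R := ℝ)
    (MvPolynomial.C ε₀ * MvPolynomial.X 0 : MvPolynomial (Fin 2) ℚ)
  have h1 := isSemialgebraic_setOf_eval_pos (k := ℚ) (R := ℝ)
    (MvPolynomial.C ε₁ * MvPolynomial.X 1 : MvPolynomial (Fin 2) ℚ)
  have h2 := isSemialgebraic_setOf_eval_le (k := ℚ) (R := ℝ)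
    (MvPolynomial.X 0 ^ 2 + MvPolynomial.X 1 ^ 2 : MvPolynomial (Fin 2) ℚ) 1
  have h := h0.inter (h1.inter h2)
  simp only [map_mul, MvPolynomial.aeval_C, MvPolynomial.aeval_X, map_add, map_pow, map_one,
    eq_ratCast] at h
  have hset : soloInformedQuarterDisc ε₀ ε₁ = {x : Fin 2 → ℝ | 0 < (ε₀ : ℝ) * x 0} ∩
      ({x | 0 < (ε₁ : ℝ) * x 1} ∩ {x | x 0 ^ 2 + x 1 ^ 2 ≤ 1}) := by
    ext x; simp [soloInformedQuarterDisc]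
  rw [hset]
  exact h

/-- The first quarter, without casts. -/
theorem soloInformed_mem_quarterDisc_one_one {x : Fin 2 → ℝ} :
    x ∈ soloInformedQuarterDisc 1 1 ↔ 0 < x 0 ∧ 0 < x 1 ∧ x 0 ^ 2 + x 1 ^ 2 ≤ 1 := by
  simp [soloInformedQuarterDisc]

/-- The quarter representations `[quarter, 1]` (restrictions of `KZ.piRep`). -/
def soloInformedQuarterRep (ε₀ ε₁ : ℚ) : IntegralRep 2 :=
  piRep.restrict (soloInformedQuarterDisc ε₀ ε₁) (isSemialgebraic_soloInformedQuarterDisc ε₀ ε₁)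
    fun _ hx => hx.2.2

/-- Domain of a quarter representation. -/
@[simp] theorem soloInformedQuarterRep_domain (ε₀ ε₁ : ℚ) :
    (soloInformedQuarterRep ε₀ ε₁).domain = soloInformedQuarterDisc ε₀ ε₁ := rfl

/-- Integrand of a quarter representation. -/
@[simp] theorem soloInformedQuarterRep_integrand (ε₀ ε₁ : ℚ) :
    (soloInformedQuarterRep ε₀ ε₁).integrand = fun _ => 1 := rfl

/-- The sign table of the four quadrants (counter-clockwise): first coordinate. -/
def soloInformedSign₀ : Fin 4 → ℚ := ![1, -1, -1, 1]

/-- The sign table of the four quadrants (counter-clockwise): second coordinate. -/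
def soloInformedSign₁ : Fin 4 → ℚ := ![1, 1, -1, -1]

/-- Value of the first sign table at `0`. -/
@[simp] theorem soloInformedSign₀_zero : soloInformedSign₀ 0 = 1 := rfl
/-- Value of the first sign table at `1`. -/
@[simp] theorem soloInformedSign₀_one : soloInformedSign₀ 1 = -1 := rfl
/-- Value of the first sign table at `2`. -/
@[simp] theorem soloInformedSign₀_two : soloInformedSign₀ 2 = -1 := rfl
/-- Value of the first sign table at `3`. -/
@[simp] theorem soloInformedSign₀_three : soloInformedSign₀ 3 = 1 := rfl
/-- Value of the second sign table at `0`. -/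
@[simp] theorem soloInformedSign₁_zero : soloInformedSign₁ 0 = 1 := rfl
/-- Value of the second sign table at `1`. -/
@[simp] theorem soloInformedSign₁_one : soloInformedSign₁ 1 = 1 := rfl
/-- Value of the second sign table at `2`. -/
@[simp] theorem soloInformedSign₁_two : soloInformedSign₁ 2 = -1 := rfl
/-- Value of the second sign table at `3`. -/
@[simp] theorem soloInformedSign₁_three : soloInformedSign₁ 3 = -1 := rfl

/-- The four quarter representations. -/
def soloInformedQuarter (i : Fin 4) : IntegralRep 2 :=
  soloInformedQuarterRep (soloInformedSign₀ i) (soloInformedSign₁ i)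

/-- A point of the plane lies in at most one open quadrant. -/
theorem soloInformed_quarter_eq_of_mem {i j : Fin 4} {x : Fin 2 → ℝ}
    (hi : x ∈ (soloInformedQuarter i).domain) (hj : x ∈ (soloInformedQuarter j).domain) :
    i = j := by
  obtain ⟨a, b, -⟩ := hi
  obtain ⟨c, d, -⟩ := hj
  fin_cases i <;> fin_cases j <;> norm_num [soloInformedSign₀, soloInformedSign₁] at a b c d ⊢ <;>
    linarith

/-- **Step 1.** `[disc, 1] − ∑ᵢ [quarterᵢ, 1] ∈ relations` (rule (1a); the axes are null). -/
theorem soloInformed_piRep_sub_sum_quarter_mem_relations :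
    of piRep - ∑ i : Fin 4, of (soloInformedQuarter i) ∈ relations := by
  refine of_sub_sum_of_mem_relations Finset.univ piRep soloInformedQuarter
    (fun i _ => ?_) (fun i _ x _ => rfl) ?_ ?_
  · exact measure_mono_null (fun x hx => (hx.2 hx.1.2.2 : False)) measure_empty
  · -- the coordinate axes are null (`Measure.pi_hyperplane`)
    have hax : ∀ (i : Fin 2) (c : ℝ), volume {u : Fin 2 → ℝ | u i = c} = 0 := fun i c => by
      rw [volume_pi]; exact Measure.pi_hyperplane _ _ _
    refine measure_mono_null (fun x hx => ?_) (measure_union_null (hax 0 0) (hax 1 0))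
    rcases hx with ⟨hxD, hxU⟩
    rw [piRep_domain, mem_piDisc] at hxD
    by_contra hne
    simp only [mem_union, mem_setOf_eq, not_or] at hne
    apply hxU
    simp only [mem_iUnion, Finset.mem_univ, exists_prop, true_and]
    rcases lt_or_lt_iff_ne.mpr hne.1 with h0 | h0 <;> rcases lt_or_lt_iff_ne.mpr hne.2 with h1 | h1
    · refine ⟨2, ?_⟩
      show x ∈ soloInformedQuarterDisc (soloInformedSign₀ 2) (soloInformedSign₁ 2)
      rw [soloInformedSign₀_two, soloInformedSign₁_two]
      refine ⟨?_, ?_, hxD⟩ <;> push_cast <;> linarith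
    · refine ⟨1, ?_⟩
      show x ∈ soloInformedQuarterDisc (soloInformedSign₀ 1) (soloInformedSign₁ 1)
      rw [soloInformedSign₀_one, soloInformedSign₁_one]
      refine ⟨?_, ?_, hxD⟩ <;> push_cast <;> linarith
    · refine ⟨3, ?_⟩
      show x ∈ soloInformedQuarterDisc (soloInformedSign₀ 3) (soloInformedSign₁ 3)
      rw [soloInformedSign₀_three, soloInformedSign₁_three]
      refine ⟨?_, ?_, hxD⟩ <;> push_cast <;> linarith
    · refine ⟨0, ?_⟩
      show x ∈ soloInformedQuarterDisc (soloInformedSign₀ 0) (soloInformedSign₁ 0)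
      rw [soloInformedSign₀_zero, soloInformedSign₁_zero]
      refine ⟨?_, ?_, hxD⟩ <;> push_cast <;> linarith
  · intro i _ j _ hij
    exact measure_mono_null (fun x hx => hij (soloInformed_quarter_eq_of_mem hx.1 hx.2))
      measure_empty

/-! ### Step 2: sign flips identify the quarters -/

/-- The diagonal linear map `x ↦ (εⱼ xⱼ)ⱼ`. -/
def soloInformedFlip {k : ℕ} (ε : Fin k → ℚ) : (Fin k → ℝ) →L[ℝ] (Fin k → ℝ) :=
  ContinuousLinearMap.pi fun j => ((ε j : ℚ) : ℝ) • ContinuousLinearMap.proj j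

/-- Coordinates of the diagonal map. -/
@[simp] theorem soloInformedFlip_apply {k : ℕ} (ε : Fin k → ℚ) (x : Fin k → ℝ) (j : Fin k) :
    soloInformedFlip ε x j = (ε j : ℝ) * x j := by
  simp [soloInformedFlip]

/-- **A linear involution with `ℚ`-polynomial entries is a change-of-variables move** between a
representation and its pull-back (rule (2) with `|det| = 1`). -/
theorem soloInformed_of_sub_of_linInvol_mem_relations {k : ℕ} (L : (Fin k → ℝ) →L[ℝ] (Fin k → ℝ))
    (P : Fin k → MvPolynomial (Fin k) ℚ) (hP : ∀ x j, L x j = MvPolynomial.aeval x (P j))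
    (hL : ∀ x, L (L x) = x) (r r' : IntegralRep k)
    (hdom : ∀ y, y ∈ r'.domain ↔ L y ∈ r.domain)
    (hint : ∀ x ∈ r.domain, r.integrand x = r'.integrand (L x)) :
    of r - of r' ∈ relations := by
  have hdet : |L.det| = 1 := soloInformed_abs_det_eq_one_of_involutive L hL
  have himage : L '' r.domain = r'.domain := by
    ext y
    constructor
    · rintro ⟨x, hx, rfl⟩
      exact (hdom _).2 (by rw [hL]; exact hx)
    · intro hy
      exact ⟨L y, (hdom y).1 hy, hL y⟩
  have hLsa : IsSemialgebraicMapOn ℚ r.domain L := by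
    refine (isSemialgebraicMapOn_aeval r.isSemialgebraic_domain P).congr fun x _ => ?_
    ext j
    exact (hP x j).symm
  have hinj : InjOn L r.domain := fun x _ y _ hxy => by rw [← hL x, hxy, hL]
  refine changeOfVariablesRel_subset_relations ⟨k, r, r', L, fun _ => L, hLsa,
    fun _ _ => L.hasFDerivWithinAt, hinj, himage.symm, fun x hx => ?_, rfl⟩
  rw [hdet, mul_one]
  exact hint x hx

/-- A sign flip identifies the quarter `(ε₀, ε₁)` with the first quarter. -/
theorem soloInformed_quarterRep_sub_mem_relations (ε₀ ε₁ : ℚ) (h₀ : ε₀ ^ 2 = 1)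
    (h₁ : ε₁ ^ 2 = 1) :
    of (soloInformedQuarterRep ε₀ ε₁) - of (soloInformedQuarterRep 1 1) ∈ relations := by
  have h₀' : (ε₀ : ℝ) ^ 2 = 1 := by exact_mod_cast h₀
  have h₁' : (ε₁ : ℝ) ^ 2 = 1 := by exact_mod_cast h₁
  have e₀ : ∀ t : ℝ, (ε₀ : ℝ) * ((ε₀ : ℝ) * t) = t := fun t => by
    rw [← mul_assoc, ← sq, h₀', one_mul]
  have e₁ : ∀ t : ℝ, (ε₁ : ℝ) * ((ε₁ : ℝ) * t) = t := fun t => by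
    rw [← mul_assoc, ← sq, h₁', one_mul]
  have p₀ : ∀ t : ℝ, ((ε₀ : ℝ) * t) ^ 2 = t ^ 2 := fun t => by rw [mul_pow, h₀', one_mul]
  have p₁ : ∀ t : ℝ, ((ε₁ : ℝ) * t) ^ 2 = t ^ 2 := fun t => by rw [mul_pow, h₁', one_mul]
  refine soloInformed_of_sub_of_linInvol_mem_relations (soloInformedFlip ![ε₀, ε₁])
    (fun j => MvPolynomial.C (![ε₀, ε₁] j) * MvPolynomial.X j) (fun x j => by simp)
    (fun x => ?_) _ _ (fun y => ?_) (fun x _ => rfl)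
  · ext j
    fin_cases j
    · simp [e₀]
    · simp [e₁]
  · simp only [soloInformedQuarterRep_domain, soloInformedQuarterDisc, mem_setOf_eq,
      soloInformedFlip_apply, Matrix.cons_val_zero, Matrix.cons_val_one,
      Rat.cast_one, one_mul, e₀, e₁, p₀, p₁]

/-- **Step 2.** Every quarter is equivalent to the first one. -/
theorem soloInformed_quarter_sub_quarter_zero_mem_relations (i : Fin 4) :
    of (soloInformedQuarter i) - of (soloInformedQuarter 0) ∈ relations := by
  have h : soloInformedSign₀ i ^ 2 = 1 ∧ soloInformedSign₁ i ^ 2 = 1 := by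
    fin_cases i <;> norm_num [soloInformedSign₀, soloInformedSign₁]
  exact soloInformed_quarterRep_sub_mem_relations _ _ h.1 h.2


end Summit.KontsevichZagierPeriods.KontsevichZagierPeriods.Theorems
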